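import Summits.ValiantsHypothesis.ValiantsHypothesis.Theorems.LacunarySymmetroidMatrixDescartesNsdPivotLoneFullRankFourEight
import Summits.ValiantsHypothesis.ValiantsHypothesis.Theorems.LacunarySymmetroidMatrixDescartesCensusPivotNormalForm

/-!
# `MatrixDescartes` (stmt-ValiantsHypothesis-18050) — the `(1 | K−1)` NSD rows for EVERY `K ≥ 4`:
# rank-one lone letter `∈ [7, 2K − 1]`, free lone letter `∈ [8, 2K]` (zero-padding floors + the tree's ceilings)

HONEST FRAMING.  Cell `pub-symmetroid`, seat `val-sym-mdr-p2` (gen 28); helper file `--supports` the crux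
`Theses.LacunarySymmetroid.MatrixDescartes` (OPEN), NO closure claim.  BOOKKEEPING over this seat's two `K = 4` objects
(`…NsdPivotLoneRankOneFourSeven`: EXACTLY 7 with a rank-one lone letter; `…NsdPivotLoneFullRankFourEight`: EXACTLY 8 with a full-rank lone
letter) and the tree's padding invariance `Pivot.pivotPosRoots_snoc_zero` (typer g8, `…CensusPivotNormalForm`): padding a pencil with ZERO
letters at exponents above the pivot keeps it in the `(1 | K−1)` classes and keeps its root count, so the `K = 4` values are FLOORS for every
`K ≥ 4`; the CEILINGS are gen 27's end law (`NsdLoneRankOne.pivotPosRoots_succ_le_of_lone_below`, `2K − 1`) and val-sym-mdr-p1's NSD `2K` law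
(`DefinitePivot.pivotPosRoots_le_two_mul_of_det_nonneg`).  So for every `K ≥ 4`:
* `loneBelow_rankOne_bracket`: a budget valid for the rank-one-lone `(1 | K−1)` NSD class is `≥ 7`, and `2K − 1` is valid;
* `loneBelow_bracket`: a budget valid for the `(1 | K−1)` NSD class (lone letter of any rank) is `≥ 8`, and `2K` is valid.
The true rows for `K ≥ 5` are OPEN (located: `7` at `K = 5` in every structured hunt of gens 27–28; seat memo CASCADE.md explains why the
`K = 4` mechanism does not iterate).  Zero letters are degenerate members of the classes AS TYPED (`P k ⪰ 0` only); the floors say nothing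
about classes that would require non-zero or rank-one upper letters.  Nothing here bears on `MatrixDescartes` in its window, on `DoorA26` /
`DoorA34`, on the cell's registers, or on `VP ≠ VNP`.

[folklore] zero-padding (tree) + the two certificates (tree, this seat); no definitions, no named facts.
-/

-- `Summit.ValiantsHypothesis.ValiantsHypothesis.…` repeats a component by the D-0017 layout
-- (single-conjunct summit), which the `dupNamespace` linter flags; the name is mandated.
set_option linter.dupNamespace false

namespace Summit.ValiantsHypothesis.ValiantsHypothesis.Theorems.LacunarySymmetroidMatrixDescartes.Pivot.NsdLoneLadder

open Polynomial Matrix Finset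
open scoped BigOperators

/-! ## 1. Zero-padding (no definitions: the padded pencils are produced existentially, by induction on the number of pads) -/

/-- **Padding step, rank-one-lone class.**  If some `(1 | K−1)` NSD pencil with pivot `J` at exponent `6`, lone index `0` of rank `≤ 1`,
has exactly `N` positive roots, then so does some `(1 | K)` pencil (append a ZERO letter at exponent `7`; tree `Pivot.pivotPosRoots_snoc_zero`).
[bookkeeping] -/
theorem exists_pad_rankOne (J : Matrix (Fin 2) (Fin 2) ℝ) (N : ℕ) :
    ∀ n : ℕ, (∃ (d : Fin (4 + 0) → ℕ) (P : Fin (4 + 0) → Matrix (Fin 2) (Fin 2) ℝ),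
        (∀ k, (P k).PosSemidef) ∧ d 0 < 6 ∧ (∀ k, k ≠ 0 → 6 < d k) ∧ (P 0).det = 0 ∧ pivotPosRoots 6 d J P = N) →
      ∃ (d : Fin (4 + n) → ℕ) (P : Fin (4 + n) → Matrix (Fin 2) (Fin 2) ℝ),
        (∀ k, (P k).PosSemidef) ∧ d 0 < 6 ∧ (∀ k, k ≠ 0 → 6 < d k) ∧ (P 0).det = 0 ∧ pivotPosRoots 6 d J P = N := by
  intro n h0
  induction n with
  | zero => exact h0
  | succ n ih =>
    obtain ⟨d, P, hP, hbot, hup, hdet, hZ⟩ := ih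
    refine ⟨(Fin.snoc d 7 : Fin (4 + n + 1) → ℕ), (Fin.snoc P (0 : Matrix (Fin 2) (Fin 2) ℝ) : Fin (4 + n + 1) → Matrix (Fin 2) (Fin 2) ℝ), ?_, ?_, ?_, ?_, ?_⟩
    · intro k
      refine Fin.lastCases ?_ (fun i => ?_) k
      · erw [Fin.snoc_last]; exact Matrix.PosSemidef.zero
      · erw [Fin.snoc_castSucc]; exact hP i
    · have h0 : (0 : Fin (4 + n + 1)) = Fin.castSucc (0 : Fin (4 + n)) := rfl
      rw [h0, Fin.snoc_castSucc]; exact hbot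
    · intro k
      refine Fin.lastCases (fun _ => ?_) (fun i hi => ?_) k
      · erw [Fin.snoc_last]; norm_num
      · erw [Fin.snoc_castSucc]
        exact hup i fun h => hi (by rw [h]; rfl)
    · have h0 : (0 : Fin (4 + n + 1)) = Fin.castSucc (0 : Fin (4 + n)) := rfl
      rw [h0, Fin.snoc_castSucc]; exact hdet
    · rw [pivotPosRoots_snoc_zero, hZ]

/-- **Padding step, free-lone class** (no rank condition). [bookkeeping] -/
theorem exists_pad (J : Matrix (Fin 2) (Fin 2) ℝ) (N : ℕ) :
    ∀ n : ℕ, (∃ (d : Fin (4 + 0) → ℕ) (P : Fin (4 + 0) → Matrix (Fin 2) (Fin 2) ℝ),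
        (∀ k, (P k).PosSemidef) ∧ d 0 < 6 ∧ (∀ k, k ≠ 0 → 6 < d k) ∧ pivotPosRoots 6 d J P = N) →
      ∃ (d : Fin (4 + n) → ℕ) (P : Fin (4 + n) → Matrix (Fin 2) (Fin 2) ℝ),
        (∀ k, (P k).PosSemidef) ∧ d 0 < 6 ∧ (∀ k, k ≠ 0 → 6 < d k) ∧ pivotPosRoots 6 d J P = N := by
  intro n h0
  induction n with
  | zero => exact h0
  | succ n ih =>
    obtain ⟨d, P, hP, hbot, hup, hZ⟩ := ih
    refine ⟨(Fin.snoc d 7 : Fin (4 + n + 1) → ℕ), (Fin.snoc P (0 : Matrix (Fin 2) (Fin 2) ℝ) : Fin (4 + n + 1) → Matrix (Fin 2) (Fin 2) ℝ), ?_, ?_, ?_, ?_⟩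
    · intro k
      refine Fin.lastCases ?_ (fun i => ?_) k
      · erw [Fin.snoc_last]; exact Matrix.PosSemidef.zero
      · erw [Fin.snoc_castSucc]; exact hP i
    · have h0 : (0 : Fin (4 + n + 1)) = Fin.castSucc (0 : Fin (4 + n)) := rfl
      rw [h0, Fin.snoc_castSucc]; exact hbot
    · intro k
      refine Fin.lastCases (fun _ => ?_) (fun i hi => ?_) k
      · erw [Fin.snoc_last]; norm_num
      · erw [Fin.snoc_castSucc]
        exact hup i fun h => hi (by rw [h]; rfl)
    · rw [pivotPosRoots_snoc_zero, hZ]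

/-! ## 2. The floors for every `K ≥ 4` -/

/-- **Rank-one lone letter, every `K ≥ 4`: the class row is `≥ 7`.**  Any budget valid for every `2 × 2` pivot pencil with `−J ⪰ 0` and `K`
PSD letters, exactly one of which — of rank `≤ 1` — lies strictly below the pivot exponent and all others strictly above, is at least `7`
(the `K = 4` seven-object padded with `K − 4` zero letters). [folklore] -/
theorem seven_le_budget_loneBelow_rankOne {K B : ℕ} (hK : 4 ≤ K)
    (h : ∀ (e : ℕ) (d : Fin K → ℕ) (J : Matrix (Fin 2) (Fin 2) ℝ) (P : Fin K → Matrix (Fin 2) (Fin 2) ℝ) (k₀ : Fin K),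
        (-J).PosSemidef → (∀ k, (P k).PosSemidef) → d k₀ < e → (∀ k, k ≠ k₀ → e < d k) → (P k₀).det = 0 →
        pivotPosRoots e d J P ≤ B) : 7 ≤ B := by
  obtain ⟨n, rfl⟩ := Nat.exists_eq_add_of_le hK
  obtain ⟨d, P, hP, hbot, hup, hdet, hZ⟩ := exists_pad_rankOne _ 7 n
    ⟨(![0, 7, 23, 120] : Fin 4 → ℕ), (![!![(3248752 : ℝ), (0 : ℝ); (0 : ℝ), (0 : ℝ)],
         !![(14356521 : ℝ), (26928423 : ℝ); (26928423 : ℝ), (50509449 : ℝ)],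
         !![(262144 : ℝ), (22538240 : ℝ); (22538240 : ℝ), (1937760400 : ℝ)],
         !![(1760929 : ℝ), (124212508 : ℝ); (124212508 : ℝ), (8761708816 : ℝ)]] : Fin 4 → Matrix (Fin 2) (Fin 2) ℝ),
      NsdLoneRankOneFourSeven.P_posSemidef, by simp, by intro k hk; fin_cases k <;> simp_all, NsdLoneRankOneFourSeven.lone_det,
      NsdLoneRankOneFourSeven.pivotPosRoots_eq_seven⟩
  have hpad := h 6 d _ P 0 NsdLoneRankOneSeven.neg_J_posSemidef hP hbot hup hdet
  rwa [hZ] at hpad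

/-- **Free lone letter, every `K ≥ 4`: the class row is `≥ 8`** (the `K = 4` eight-object padded with zero letters). [folklore] -/
theorem eight_le_budget_loneBelow {K B : ℕ} (hK : 4 ≤ K)
    (h : ∀ (e : ℕ) (d : Fin K → ℕ) (J : Matrix (Fin 2) (Fin 2) ℝ) (P : Fin K → Matrix (Fin 2) (Fin 2) ℝ) (k₀ : Fin K),
        (-J).PosSemidef → (∀ k, (P k).PosSemidef) → d k₀ < e → (∀ k, k ≠ k₀ → e < d k) →
        pivotPosRoots e d J P ≤ B) : 8 ≤ B := by
  obtain ⟨n, rfl⟩ := Nat.exists_eq_add_of_le hK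
  obtain ⟨d, P, hP, hbot, hup, hZ⟩ := exists_pad _ 8 n
    ⟨(![0, 7, 23, 120] : Fin 4 → ℕ), (![!![(3248752 : ℝ), (0 : ℝ); (0 : ℝ), (1 : ℝ)],
         !![(14356521 : ℝ), (26928423 : ℝ); (26928423 : ℝ), (50509449 : ℝ)],
         !![(262144 : ℝ), (22538240 : ℝ); (22538240 : ℝ), (1937760400 : ℝ)],
         !![(1760929 : ℝ), (124212508 : ℝ); (124212508 : ℝ), (8761708816 : ℝ)]] : Fin 4 → Matrix (Fin 2) (Fin 2) ℝ),
      NsdLoneFullRankFourEight.P_posSemidef, by simp, by intro k hk; fin_cases k <;> simp_all,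
      NsdLoneFullRankFourEight.pivotPosRoots_eq_eight⟩
  have hpad := h 6 d _ P 0 NsdLoneRankOneSeven.neg_J_posSemidef hP hbot hup
  rwa [hZ] at hpad

/-! ## 3. The brackets for every `K ≥ 4` -/

/-- **THE RANK-ONE-LONE `(1 | K−1)` NSD ROW LIES IN `[7, 2K − 1]` FOR EVERY `K ≥ 4`**: every valid budget is `≥ 7` (§2), and `2K − 1` is
valid (gen 27's END LAW `NsdLoneRankOne.pivotPosRoots_succ_le_of_lone_below`).  `K = 4`: `7 = 2K − 1`, exact (`…NsdPivotLoneRankOneFourSeven`);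
`K ≥ 5`: OPEN inside the bracket. [folklore] -/
theorem loneBelow_rankOne_bracket {K : ℕ} (hK : 4 ≤ K) :
    (∀ B : ℕ, (∀ (e : ℕ) (d : Fin K → ℕ) (J : Matrix (Fin 2) (Fin 2) ℝ) (P : Fin K → Matrix (Fin 2) (Fin 2) ℝ) (k₀ : Fin K),
        (-J).PosSemidef → (∀ k, (P k).PosSemidef) → d k₀ < e → (∀ k, k ≠ k₀ → e < d k) → (P k₀).det = 0 →
        pivotPosRoots e d J P ≤ B) → 7 ≤ B) ∧
    (∀ (e : ℕ) (d : Fin K → ℕ) (J : Matrix (Fin 2) (Fin 2) ℝ) (P : Fin K → Matrix (Fin 2) (Fin 2) ℝ) (k₀ : Fin K),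
        (-J).PosSemidef → (∀ k, (P k).PosSemidef) → d k₀ < e → (∀ k, k ≠ k₀ → e < d k) → (P k₀).det = 0 →
        pivotPosRoots e d J P ≤ 2 * K - 1) := by
  refine ⟨fun B hB => seven_le_budget_loneBelow_rankOne hK hB, fun e d J P k₀ hJ hP hbot hup hrk => ?_⟩
  have h := NsdLoneRankOne.pivotPosRoots_succ_le_of_lone_below e d J P hJ hP k₀ hbot hup hrk
  omega

/-- **THE `(1 | K−1)` NSD ROW (lone letter of any rank) LIES IN `[8, 2K]` FOR EVERY `K ≥ 4`**: every valid budget is `≥ 8` (§2), and `2K` is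
valid (the tree's NSD `2K` law).  `K = 4`: `8 = 2K`, exact (`…NsdPivotLoneFullRankFourEight`); `K ≥ 5`: OPEN inside the bracket. [folklore] -/
theorem loneBelow_bracket {K : ℕ} (hK : 4 ≤ K) :
    (∀ B : ℕ, (∀ (e : ℕ) (d : Fin K → ℕ) (J : Matrix (Fin 2) (Fin 2) ℝ) (P : Fin K → Matrix (Fin 2) (Fin 2) ℝ) (k₀ : Fin K),
        (-J).PosSemidef → (∀ k, (P k).PosSemidef) → d k₀ < e → (∀ k, k ≠ k₀ → e < d k) →
        pivotPosRoots e d J P ≤ B) → 8 ≤ B) ∧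
    (∀ (e : ℕ) (d : Fin K → ℕ) (J : Matrix (Fin 2) (Fin 2) ℝ) (P : Fin K → Matrix (Fin 2) (Fin 2) ℝ),
        (-J).PosSemidef → (∀ k, (P k).PosSemidef) → pivotPosRoots e d J P ≤ 2 * K) := by
  refine ⟨fun B hB => eight_le_budget_loneBelow hK hB, fun e d J P hJ hP => ?_⟩
  have hdet : 0 ≤ J.det := by
    have h := hJ.det_nonneg
    rwa [Matrix.det_neg, Fintype.card_fin, show ((-1 : ℝ) ^ 2) = 1 by norm_num, one_mul] at h
  exact DefinitePivot.pivotPosRoots_le_two_mul_of_det_nonneg e d J P hP hdet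

end Summit.ValiantsHypothesis.ValiantsHypothesis.Theorems.LacunarySymmetroidMatrixDescartes.Pivot.NsdLoneLadder
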